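import Summits.BirchSwinnertonDyer.BirchSwinnertonDyer.Theorems.UniversalToricDescentTwinSplitIMCAtThreeOfThreeFrames
import Summits.BirchSwinnertonDyer.BirchSwinnertonDyer.Theorems.UniversalToricDescentTwinSplitIMCAtThreeSupsetGoodOrd
import Literature.NumberTheory.EllipticCurves.CastellaCiperianiSkinnerSprung2018.AnticyclotomicHowardDivisibilityOPEN
import HarnessLib

/-!
# Route `UniversalToricDescent`, crux #3 `TwinSplitIMCAtThree` (item stmt-BirchSwinnertonDyer-20214) ON
# BUCKET C (good-SUPERSINGULAR twins, 603 of the 2 023 twin classes): the `⊇`-half at EVERY frame, conjunct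
# (i) and `Λ`-torsion, by name of ONE explicitly labelled OPEN claim (Castella–Çiperiani–Skinner–Sprung
# 2018, Thm. 5.7 + Lemma 5.5, PREPRINT); and crux #3 verbatim on bucket C from that claim, Hsieh's
# `μ = 0`, and ONE rational Wan-direction frame

Seat `bsd-wall-utd-p2` g2 (D-0131 (3) MIDDLE tier, strategy «twin-split IMC at 3, ⊇-half only: Howard 2004
/ BCK21 transfer pushed to `p = 3` on the 2 023 twin classes (TWIN-PRINT-AT3 v1 §1 gap list as the work
order)»; memo `HOME/bsd-wall/bsd-wall-utd-p2/SUPSET-AT3-v4.md`). Rows 3–4 of that gap list (good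
supersingular twins, `a_3 = 0` or `±3`). Kernel-checked, sorry-free, CONDITIONAL on:
* `hC` = `CastellaCiperianiSkinnerSprung2018.thm57_lemma55_exists_isBDPLFunction_isTorsion_mem_charIdeal_OPEN`
  (p545192) — an OPEN CLAIM of an UNREFEREED PREPRINT (arXiv:1804.10993v2, 2018: Thm. 5.7 + Lemma 5.5 as
  combined in the first display of the proof of Thm. 5.8, `[corpus: paper:arxiv-1804.10993 p0022 L79–L97,
  p0021 L109–L137, p0023 L2–L17]`; standing §4 "`p > 2` … good non-ordinary", `p` split, `N⁻ = 1` allowed),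
  typed in the shape of BCS 2025 Thm. 4.2.1 (b) with `GoodSS` for `GoodOrd` and NO (disc)/(sur) — NOT a
  theorem of the literature: the refereed version of the same Kolyvagin-system argument (Castella–Wan,
  Math. Ann. 389 (2024) §5.4 Thm. 5.12) has standing `p > 3`, `p ∤ 6N_fD_K`;
* `h422` = `BurungaleCastellaSkinner2025.prop422_exists_isBDPLFunction_mu_eq_zero` (refereed; Hsieh 2014
  Thm. B; good reduction at `p > 2`, no ordinarity) — only for the last theorem.

* `exists_howardFrame_isTorsion_of_goodSS_of_ccss` — `W′` globally minimal, `GoodSS W′ 3`, `ρ̄_{W′,3}` onto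
  over `ℚ`, `K` imaginary quadratic Heegner for `N′`, `3 = 𝔭𝔭′` split (`𝔭` of degree one, `𝔭′ ≠ 𝔭`), `κ`
  anticyclotomic, `ι′` inducing `𝔭`: `X_ac(W′_K)` strict at `𝔭′` is `Λ`-torsion and there is a frame
  `(Ω_K ≠ 0, Ω_p ≠ 0, L)` of `f_{W′}` at `(ι′, 𝔭)` with `L ∈ Ch_Λ(X_ac)·R₀⟦T⟧` — NO `D_K` hypothesis.
* `crux_conjunct_one_and_supset_forall_frame_of_goodSS_of_ccss` — hence (by `…_of_howardFrame`, p543791)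
  conjunct (i) verbatim, torsion, and the `⊇`-half of (ii), `(L′) ⊆ Ch·R₀⟦T⟧`, at EVERY frame `L′`.
* `twinSplit_instance_of_goodSS_of_ccss_of_wanFrame` — with `D_K` odd and ONE rational Wan frame
  (`∃ k, 3^k·Ch·R₀⟦T⟧ ⊆ (L₂)` at some frame: NOT in print at `p = 3` under `N⁻ = 1`, not even as a
  preprint), conjuncts (i) ∧ (ii) of `TwinSplitIMCAtThree` verbatim (`…_of_howardFrame_of_wanFrame_of_good`).

PARTITION currency (census TWIN-PRINT-AT3-v1 §2): bucket C = **603 of the 2 023** twin classes (29.8 %;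
every class has an `a_3 = 0` twin in range, QC1-BUCKETC-A3ZERO-TWINS-v1): the `⊇`-half of crux #3 + (i) +
torsion now hold at every bucket-C instance BY NAME OF ONE PRE CLAIM; crux #3 itself there ⟸ that claim ∧
the refereed `h422` ∧ ONE rational Wan frame. Bucket A (745): refereed by name (p540959). Bucket B (675):
three frames, none in print (p543791). Classes CLOSED: 0. Beyond-print BSD theorem: NO; beyond-REFEREED
print: the bucket-C `⊇` rests on an unrefereed 2018 claim, labelled as such. `--supports stmt-BirchSwinnertonDyer-20214`.

References: [CastellaCiperianiSkinnerSprung2018] Thm. 5.7, Lemma 5.5, Thm. 5.8 (arXiv:1804.10993v2 §5.1);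
[CastellaWan2024PerrinRiou] §5.4 Thm. 5.12; [BurungaleCastellaSkinner2025] Prop. 4.2.2; [Hsieh2014] Thm. B;
[Castella2018] Thm. 3.1 (the frame predicate).
-/

noncomputable section

open scoped Classical

set_option linter.dupNamespace false
set_option autoImplicit false


namespace Summit.BirchSwinnertonDyer.BirchSwinnertonDyer.Theorems.UniversalToricDescentTwinSplit

open Filter PowerSeries WeierstrassCurve NumberField IsDedekindDomain Field
  Literature.NumberTheory.EllipticCurves
  Literature.NumberTheory.EllipticCurves.ModularForms
  Literature.NumberTheory.EllipticCurves.Rank1Residual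
  Literature.NumberTheory.GaloisRepresentations
  Summit.BirchSwinnertonDyer.Rank1Residual
  Summit.BirchSwinnertonDyer.Rank1Residual.X11b
  Summit.BirchSwinnertonDyer.Rank1Residual.X11b.Halves
  Summit.BirchSwinnertonDyer.BirchSwinnertonDyer.Theorems.SchneiderFree

/-- **A HOWARD FRAME for a good-SUPERSINGULAR twin at `p = 3`, by name of the CÇSS18 claim.** `W′`
globally minimal, `GoodSS W′ 3` (good at `3`, `3 ∣ a_3`), `ρ̄_{W′,3}` onto over `ℚ`; `K` imaginary quadratic
with the Heegner hypothesis for `N′`; `κ` anticyclotomic with topological generator `γ`; `𝔭 ∋ 3` of degree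
one, `𝔭′ ∋ 3`, `𝔭′ ≠ 𝔭`; `ι′` inducing `𝔭`: a frame `(Ω_K ≠ 0, Ω_p ≠ 0, L)` of `f_{W′}` at `(ι′, 𝔭)` with
`X_ac(W′_K)` strict at `𝔭′` `Λ`-torsion and `L ∈ Ch_Λ(X_ac)·R₀⟦T⟧` along `toUnr 3`. NO `D_K` hypothesis.
CONDITIONAL on the OPEN claim `hC` (unrefereed preprint).
[cite: CastellaCiperianiSkinnerSprung2018, Thm. 5.7, Lemma 5.5, proof of Thm. 5.8 (arXiv:1804.10993v2 §5.1)] -/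
theorem exists_howardFrame_isTorsion_of_goodSS_of_ccss
    (hC : CastellaCiperianiSkinnerSprung2018.thm57_lemma55_exists_isBDPLFunction_isTorsion_mem_charIdeal_OPEN)
    (W' : WeierstrassCurve ℚ) [W'.IsElliptic] [W'.IsGloballyMinimal] (N' : ℕ) [NeZero N']
    (K : Type) [Field K] [NumberField K] (Dt' : ModularParametrizationData W' N')
    (hss : GoodSS W' 3) (hsurj : W'.HasSurjectiveModNGaloisRep 3)
    (hK : IsImaginaryQuadratic K) (hH : SatisfiesHeegnerHypothesis N' K)
    (κ : ZpExtension K 3) (hκ : κ.IsAnticyclotomic) (γ : absoluteGaloisGroup K)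
    [Fact (κ.IsTopGenerator γ)]
    (𝔭 : HeightOneSpectrum (𝓞 K)) (h𝔭 : ((3 : ℕ) : 𝓞 K) ∈ 𝔭.asIdeal)
    (he : 𝔭.asIdeal.ramificationIdx (𝓞 ℚ) = 1) (hf : 𝔭.asIdeal.inertiaDeg (𝓞 ℚ) = 1)
    (𝔭' : HeightOneSpectrum (𝓞 K)) (h𝔭' : ((3 : ℕ) : 𝓞 K) ∈ 𝔭'.asIdeal) (hne : 𝔭' ≠ 𝔭)
    (ι' : PadicAlgCl 3 ≃+* ℂ) (hι' : BranchInducesPrime 3 ι' 𝔭) :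
    Module.IsTorsion (IwasawaAlgebra 3) (AcSelmer.XAc (W'.baseChange K) 3 κ 𝔭' ∅ γ) ∧
    ∃ (ΩK : ℂ) (Ωp : ℂ_[3]) (L : UnrSeries 3), ΩK ≠ 0 ∧ Ωp ≠ 0 ∧
      IsBDPLFunction ι' 𝔭 κ γ Dt'.f ΩK Ωp L ∧
      L ∈ (AcSelmer.XAc.charIdeal (W'.baseChange K) 3 κ 𝔭' ∅ γ).map (PowerSeries.map (toUnr 3)) := by
  have h2 : Module.finrank ℚ K = 2 := hK.1
  have hspl : ((Ideal.span {((3 : ℕ) : ℤ)}).primesOver (𝓞 K)).ncard = 2 :=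
    ncard_primesOver_eq_two_of_degreeOne h2 h𝔭 he hf
  have hirrK : (W'.baseChange K).HasIrreducibleModPGaloisRep 3 := irrK_of_surj W' 3 hsurj K h2
  obtain ⟨ΩK, Ωp, L, hΩK, hL, htors, hdiv⟩ :=
    hC ι' W' K 𝔭 𝔭' κ γ Dt'.isNewformOf (by decide) hss hK hH hspl hirrK hι' h𝔭' hne hκ
  refine ⟨htors, ΩK, ((Ωp : unrIntegers 3) : ℂ_[3]), L, hΩK, ?_, hL, ?_⟩
  · intro h0
    have h1 := norm_coe_units_unrIntegers 3 Ωp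
    rw [h0, norm_zero] at h1
    exact zero_ne_one h1
  · have hmem := hdiv (toUnr 3) (coe_toUnr 3)
    rw [xac_charIdeal_eq_literature (W'.baseChange K) 3 κ 𝔭' ∅ γ]
    exact hmem

/-- **Bucket C, the `⊇`-half at EVERY frame (+ conjunct (i) + torsion) by name of the CÇSS18 claim.**
For a good-supersingular twin `W′` at `3` with `ρ̄₃` onto over `ℚ` and ANY Heegner `K` with `3` split
(no `D_K` hypothesis), crux #3's conjunct (i) holds verbatim and `(L′) ⊆ Ch_Λ(X_ac(W′_K) strict at 𝔭′)·R₀⟦T⟧`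
for EVERY frame `L′` — `crux_conjunct_one_and_supset_forall_frame_of_howardFrame` (p543791) at the frame
of `exists_howardFrame_isTorsion_of_goodSS_of_ccss`. Census: bucket C = 603 of the 2 023 twin classes.
CONDITIONAL on the OPEN claim `hC` (unrefereed preprint): beyond-REFEREED-print, not beyond print.
[cite: CastellaCiperianiSkinnerSprung2018, Thm. 5.7, Lemma 5.5, proof of Thm. 5.8 (arXiv:1804.10993v2 §5.1)] -/
theorem crux_conjunct_one_and_supset_forall_frame_of_goodSS_of_ccss
    (hC : CastellaCiperianiSkinnerSprung2018.thm57_lemma55_exists_isBDPLFunction_isTorsion_mem_charIdeal_OPEN)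
    (W' : WeierstrassCurve ℚ) [W'.IsElliptic] [W'.IsGloballyMinimal] (N' : ℕ) [NeZero N']
    (K : Type) [Field K] [NumberField K] (Dt' : ModularParametrizationData W' N')
    (hss : GoodSS W' 3) (hsurj : W'.HasSurjectiveModNGaloisRep 3)
    (hK : IsImaginaryQuadratic K) (hH : SatisfiesHeegnerHypothesis N' K)
    (κ : ZpExtension K 3) (hκ : κ.IsAnticyclotomic) (γ : absoluteGaloisGroup K)
    [Fact (κ.IsTopGenerator γ)]
    (𝔭 : HeightOneSpectrum (𝓞 K)) (h𝔭 : ((3 : ℕ) : 𝓞 K) ∈ 𝔭.asIdeal)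
    (he : 𝔭.asIdeal.ramificationIdx (𝓞 ℚ) = 1) (hf : 𝔭.asIdeal.inertiaDeg (𝓞 ℚ) = 1)
    (𝔭' : HeightOneSpectrum (𝓞 K)) (h𝔭' : ((3 : ℕ) : 𝓞 K) ∈ 𝔭'.asIdeal) (hne : 𝔭' ≠ 𝔭)
    (ι' : PadicAlgCl 3 ≃+* ℂ) (hι' : BranchInducesPrime 3 ι' 𝔭) :
    Module.IsTorsion (IwasawaAlgebra 3) (AcSelmer.XAc (W'.baseChange K) 3 κ 𝔭' ∅ γ) ∧
    (∃ (ΩK : ℂ) (Ωp : ℂ_[3]) (L' : UnrSeries 3), ΩK ≠ 0 ∧ Ωp ≠ 0 ∧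
        IsBDPLFunction ι' 𝔭 κ γ Dt'.f ΩK Ωp L') ∧
      (∀ (ΩK : ℂ) (Ωp : ℂ_[3]) (L' : UnrSeries 3), ΩK ≠ 0 → Ωp ≠ 0 →
        IsBDPLFunction ι' 𝔭 κ γ Dt'.f ΩK Ωp L' →
        Ideal.span {L'} ≤
          (AcSelmer.XAc.charIdeal (W'.baseChange K) 3 κ 𝔭' ∅ γ).map (PowerSeries.map (toUnr 3))) := by
  obtain ⟨htors, hHow⟩ := exists_howardFrame_isTorsion_of_goodSS_of_ccss hC W' N' K Dt' hss hsurj hK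
    hH κ hκ γ 𝔭 h𝔭 he hf 𝔭' h𝔭' hne ι' hι'
  exact ⟨htors, crux_conjunct_one_and_supset_forall_frame_of_howardFrame W' N' K Dt' κ γ 𝔭 𝔭' ι' hK
    hκ hHow⟩

/-- **Bucket C: crux #3 VERBATIM from the CÇSS18 claim, Hsieh's `μ = 0`, and ONE rational Wan frame.**
For a good-supersingular twin `W′` at `3` with `ρ̄₃` onto over `ℚ`, `K` Heegner for `N′` with `3` split and
`D_K` odd: if SOME frame `(Ω_K ≠ 0, Ω_p ≠ 0, L₂)` of `f_{W′}` at `(ι′, 𝔭)` has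
`3^k · Ch_Λ(X_ac)·R₀⟦T⟧ ⊆ (L₂)` for some `k` (the rational Wan direction at the twin — NOT in print at
`p = 3` under `N⁻ = 1`), then conjuncts (i) ∧ (ii) of `TwinSplitIMCAtThree` hold verbatim at
`(W′, N′, K, Dt′, κ, γ, 𝔭, 𝔭′, ι′)` — `twinSplit_instance_of_howardFrame_of_wanFrame_of_good` (p543791).
CONDITIONAL on the OPEN claim `hC` and on the refereed fact `h422` (BCS 2025 Prop. 4.2.2 = Hsieh 2014 Thm. B).
[cite: CastellaCiperianiSkinnerSprung2018, Thm. 5.7, Lemma 5.5, proof of Thm. 5.8 (arXiv:1804.10993v2 §5.1)]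
[cite: BurungaleCastellaSkinner2025, Prop. 4.2.2 (§4.2, pp. 8–9 of arXiv:2405.00270v2)] -/
theorem twinSplit_instance_of_goodSS_of_ccss_of_wanFrame
    (hC : CastellaCiperianiSkinnerSprung2018.thm57_lemma55_exists_isBDPLFunction_isTorsion_mem_charIdeal_OPEN)
    (h422 : BurungaleCastellaSkinner2025.prop422_exists_isBDPLFunction_mu_eq_zero)
    (W' : WeierstrassCurve ℚ) [W'.IsElliptic] [W'.IsGloballyMinimal] (N' : ℕ) [NeZero N']
    (K : Type) [Field K] [NumberField K] (Dt' : ModularParametrizationData W' N')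
    (hss : GoodSS W' 3) (hsurj : W'.HasSurjectiveModNGaloisRep 3)
    (hK : IsImaginaryQuadratic K) (hH : SatisfiesHeegnerHypothesis N' K)
    (hodd : Odd (NumberField.discr K))
    (κ : ZpExtension K 3) (hκ : κ.IsAnticyclotomic) (γ : absoluteGaloisGroup K)
    [Fact (κ.IsTopGenerator γ)]
    (𝔭 : HeightOneSpectrum (𝓞 K)) (h𝔭 : ((3 : ℕ) : 𝓞 K) ∈ 𝔭.asIdeal)
    (he : 𝔭.asIdeal.ramificationIdx (𝓞 ℚ) = 1) (hf : 𝔭.asIdeal.inertiaDeg (𝓞 ℚ) = 1)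
    (𝔭' : HeightOneSpectrum (𝓞 K)) (h𝔭' : ((3 : ℕ) : 𝓞 K) ∈ 𝔭'.asIdeal) (hne : 𝔭' ≠ 𝔭)
    (ι' : PadicAlgCl 3 ≃+* ℂ) (hι' : BranchInducesPrime 3 ι' 𝔭)
    (hWan : ∃ (ΩK : ℂ) (Ωp : ℂ_[3]) (L : UnrSeries 3), ΩK ≠ 0 ∧ Ωp ≠ 0 ∧
      IsBDPLFunction ι' 𝔭 κ γ Dt'.f ΩK Ωp L ∧
      ∃ k : ℕ, ∀ G ∈ (AcSelmer.XAc.charIdeal (W'.baseChange K) 3 κ 𝔭' ∅ γ).map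
        (PowerSeries.map (toUnr 3)), PowerSeries.C (((3 : ℕ) : unrIntegers 3) ^ k) * G ∈ Ideal.span {L}) :
    (∃ (ΩK : ℂ) (Ωp : ℂ_[3]) (L' : UnrSeries 3), ΩK ≠ 0 ∧ Ωp ≠ 0 ∧
        IsBDPLFunction ι' 𝔭 κ γ Dt'.f ΩK Ωp L') ∧
      (∀ (ΩK : ℂ) (Ωp : ℂ_[3]) (L' : UnrSeries 3), ΩK ≠ 0 → Ωp ≠ 0 →
        IsBDPLFunction ι' 𝔭 κ γ Dt'.f ΩK Ωp L' →
        (AcSelmer.XAc.charIdeal (W'.baseChange K) 3 κ 𝔭' ∅ γ).map (PowerSeries.map (toUnr 3)) =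
          Ideal.span {L'}) := by
  obtain ⟨-, hHow⟩ := exists_howardFrame_isTorsion_of_goodSS_of_ccss hC W' N' K Dt' hss hsurj hK hH κ
    hκ γ 𝔭 h𝔭 he hf 𝔭' h𝔭' hne ι' hι'
  exact twinSplit_instance_of_howardFrame_of_wanFrame_of_good W' N' K Dt' κ γ 𝔭 𝔭' ι' h422 hss.1
    hsurj hK hH hodd hκ h𝔭 he hf hι' hHow hWan

end Summit.BirchSwinnertonDyer.BirchSwinnertonDyer.Theorems.UniversalToricDescentTwinSplit

end
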